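import Summits.Ventures.Crystal3D.Theorems.StickyWulffConstantCoaxialWallLawDebtTwinRow
import Summits.Ventures.Crystal3D.Theorems.StickyWulffConstantCoaxialWallLawDebtFaultRow
import Summits.Ventures.Crystal3D.Theorems.StickyWulffConstantCoaxialWallLawVicinalCoreCapstone
import Summits.Ventures.Crystal3D.Theorems.StickyWulffConstantCoaxialWallLawEndRowDefs
import HarnessLib

/-!
# CAPSTONE: the crux `CoaxialWallLaw` BY NAME from E1, `StarPairFar`, the two CENSUS ROWS and Debt 3

HONEST FRAMING. Venture `Summits/Ventures/Crystal3D` (cell `crystal3d-full`), helper `--supports` the crux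
`CoaxialWallLaw` (stmt-Ventures-19481, `route-Ventures-StickyWulffConstant`), REGISTERED line `WallLedgerF`, open stub
`stub_coaxialTwoSlabAdhesion`.  Rung credit; F-C1 not moved; CONDITIONAL on named facts.  cf-p1 g28 16:59:06Z re-aim
(19481-p2 g6): 19481-p1 g11's typed split `coaxialWallLaw_of_split` (`…VicinalCoreCapstone`) with Debts 1 and 2
DISCHARGED BY THE CENSUS ROWS (`coaxialTwoSlabAdhesionCoherentTwin_of_row`, `coaxialTwoSlabAdhesionCoherentFault_of_row`):

`coaxialWallLaw_of_endRows_split : KissingGap δ → KissingClassification δ → E1(s₀) → StarPairFar → 0 < s_F ≤ 2√6 →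
   EndRowTwinHalfTurn v1 s_F → EndRowTrans v1 s_F → CoaxialTwoSlabAdhesionIncoherent → CoaxialWallLaw`.

What remains OWED after this file, all BY NAME: the two census Props `EndRowTwinHalfTurn WordVersion.v1 s_F` and
`EndRowTrans WordVersion.v1 s_F` (`…EndRowDefs`; cf-p2's certificate, PREREG-F-STEP3, v1 key, threshold `2√6`), Debt 3
`CoaxialTwoSlabAdhesionIncoherent` ((F-thin-comm)/(F-loc): two-grain count `…IncoherentTwoGrain` landed as its first
input), E1 = `ExactOnly 0 (polar cap)`, `StarPairFar`, and the literature facts `KissingGap δ`, `KissingClassification δ`.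
No `EndRowTrans6` / class-(B) row any more.  WHAT THIS IS NOT: a proof of any of those; F-C1 not moved.
-/

noncomputable section

namespace Summit.Ventures.Crystal3D.Theorems

open Summit.Ventures.Crystal3D Finset
open scoped InnerProductSpace

/-- **The crux BY NAME from E1, `StarPairFar`, the twin row, the in-plane translation row and Debt 3.**  See the module
docstring. -/
theorem coaxialWallLaw_of_endRows_split {δ : ℝ} (hg : KissingGap δ) (hc : KissingClassification δ)
    {s₀ : EuclideanSpace ℝ (Fin 3)} (hs₀ : s₀ ∈ fccSlots)
    (hcert : ExactOnly 0 (fccSlots.filter fun w => 0 < ⟪w, s₀⟫_ℝ)) (hSP : StarPairFar)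
    {sF : ℝ} (hsF : 0 < sF) (hsF' : sF ≤ 2 * Real.sqrt 6)
    (hW : EndRowTwinHalfTurn WordVersion.v1 sF) (hT : EndRowTrans WordVersion.v1 sF)
    (h₃ : CoaxialTwoSlabAdhesionIncoherent) :
    Summit.Ventures.Crystal3D.Theses.StickyWulffConstant.CoaxialWallLaw :=
  coaxialWallLaw_of_split hs₀ hcert hSP (coaxialTwoSlabAdhesionCoherentTwin_of_row hg hc hsF hsF' hW)
    (coaxialTwoSlabAdhesionCoherentFault_of_row hg hc hsF hsF' hT) h₃

/-- The same with the two coherent debts exposed: **the rows discharge Debts 1 and 2 of the split.** -/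
theorem coherentDebts_of_endRows {δ : ℝ} (hg : KissingGap δ) (hc : KissingClassification δ)
    {sF : ℝ} (hsF : 0 < sF) (hsF' : sF ≤ 2 * Real.sqrt 6)
    (hW : EndRowTwinHalfTurn WordVersion.v1 sF) (hT : EndRowTrans WordVersion.v1 sF) :
    CoaxialTwoSlabAdhesionCoherentTwin ∧ CoaxialTwoSlabAdhesionCoherentFault :=
  ⟨coaxialTwoSlabAdhesionCoherentTwin_of_row hg hc hsF hsF' hW, coaxialTwoSlabAdhesionCoherentFault_of_row hg hc hsF hsF' hT⟩

end Summit.Ventures.Crystal3D.Theorems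

end
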